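import Summits.CriticalPhenomena.Ising3DConformalLimit.Theorems.FKParityRobustnessIndependentStrandsJoinEventuallyUpgrade
import Literature.Probability.LatticeModels.SourcedDoubleCurrents
import HarnessLib

/-!
# Strategy census `s7` for crux `IndependentStrandsJoin` (stmt-CriticalPhenomena-14625) — typed attempts

Planner `cstrat-stmt-CriticalPhenomena-14625-s7` (independent census, family `s`).  Signatures only
(`def … : Prop`) plus the elementary implications between them; NO stub, NO line is registered here.
Everything is stated over existing declarations:

* `R4ratio`, `U4crit`, `GGcrit`, `independentStrandsJoin_iff_forall_R4ratio` (landed, p169300/p169623: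
  the crux is kernel-equivalent to `∃ c > 0, ∀ l ≥ 1, c ≤ R4ratio l`);
* `sourcedDoubleCurrentLaw 3 N β A B` (`SourcedDoubleCurrents.lean`): the law of the trace of
  `n₁ + n₂`, `∂n₁ = A`, `∂n₂ = B`, free box `Λ_N ⊂ ℤ³`; `openConn` (`Percolation.lean`).

Contents: §1 the decomposition attempt `FatClustersMeet ∧ LoopImpact → DCJoinFloor` (+ the glue
hypothesis `AizenmanIdentityLimit` under which `DCJoinFloor → crux`); §2 the strengthenings
`R4Nondecreasing`, `OctaveStability`; §3 the negation target `TetraGaussianity → ¬ crux`.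
See `STRATEGY-CENSUS-s7.md` for the verdict on each.
-/

noncomputable section

open MeasureTheory Filter Topology
open Literature.Probability.LatticeModels Literature.Probability.Percolation
open Summit.CriticalPhenomena.Ising3DConformalLimit.Theses.FKParityRobustness
open Summit.CriticalPhenomena.Ising3DConformalLimit.Cruxes.ParityRobustMerging.PlaquetteXorSurgery (tetra)
open Summit.CriticalPhenomena.Ising3DConformalLimit.Cruxes.IndependentStrandsJoin.PinchToTetra

namespace Summit.CriticalPhenomena.Ising3DConformalLimit.Cruxes.IndependentStrandsJoin.CensusS7

/-- The dilated tetrahedral source `A_l(i) = l • tetra i`. -/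
def A (l : ℕ) (i : Fin 4) : Site 3 := (l : ℤ) • tetra i

/-! ## §1 Decomposition attempt D-b: fat clusters meet ∧ loop impact -/

/-- `q_N(l) = P^{A₀A₁}_{Λ_N} ⊗ P^{A₂A₃}_{Λ_N}[A₀ ↔ A₂ in n₁ + n₂]` at `β_c` — the PAIR-SOURCED double-current
merging probability (Aizenman 1982: `U₄ = −2⟨σσ⟩⟨σσ⟩·q`). -/
def dcJoinProb (l N : ℕ) : ℝ :=
  (sourcedDoubleCurrentLaw 3 N (criticalBeta 3) ({A l 0, A l 1} : Finset (Site 3))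
      ({A l 2, A l 3} : Finset (Site 3))).real (openConn (A l 0) (A l 2))

/-- `P^{A₀A₁,∅}_{Λ_N} ⊗ P^{A₂A₃,∅}_{Λ_N}[C_{n₁+n₃}(A₀) ∩ C_{n₂+n₄}(A₂) ∩ Λ_N ≠ ∅]` — the two INDEPENDENT
"fat" (sourced + sourceless) double-current clusters of ADC 2021 eq. (4.2) meet. -/
def fatMeetProb (l N : ℕ) : ℝ :=
  ((sourcedDoubleCurrentLaw 3 N (criticalBeta 3) ({A l 0, A l 1} : Finset (Site 3)) ∅).prod
      (sourcedDoubleCurrentLaw 3 N (criticalBeta 3) ({A l 2, A l 3} : Finset (Site 3)) ∅)).real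
    {p | ∃ u ∈ box 3 N, p.1 ∈ openConn (A l 0) u ∧ p.2 ∈ openConn (A l 2) u}

/-- `DCJoinFloor`: the pair-sourced merging probability is bounded below uniformly in the scale,
eventually in the volume.  (Crux-equivalent given `AizenmanIdentityLimit`; typed as the common target
of the two pieces below.) -/
def DCJoinFloor : Prop :=
  ∃ c : ℝ, 0 < c ∧ ∀ l : ℕ, 1 ≤ l → ∃ N₀ : ℕ, ∀ N : ℕ, N₀ ≤ N → c ≤ dcJoinProb l N

/-- Piece Q1 `FatClustersMeet`: the two independent fat clusters meet with probability `≥ c`, uniformly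
in `l ≥ 1`, eventually in `N`.  Second-moment target (ADC 2021 Lemma 4.4/6.2 machinery, in tree on
finite graphs: `Current.ikMass_lower_bound_of_twoPoint`, `sourcedDoubleCurrentLaw_real_oneArm_ge`);
needs two-sided two-point regularity with `η < 1/2`. -/
def FatClustersMeet : Prop :=
  ∃ c : ℝ, 0 < c ∧ ∀ l : ℕ, 1 ≤ l → ∃ N₀ : ℕ, ∀ N : ℕ, N₀ ≤ N → c ≤ fatMeetProb l N

/-- Piece Q2 `LoopImpact`: REVERSE of Aizenman's monotonicity `q ≤ fatMeet` (ADC 2021 (4.2)) up to a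
constant — "the impact of the additional loops" (Duminil-Copin, ICM 2022, p. 20).  No plan. -/
def LoopImpact : Prop :=
  ∃ κ : ℝ, 0 < κ ∧ ∀ l : ℕ, 1 ≤ l → ∃ N₀ : ℕ, ∀ N : ℕ, N₀ ≤ N → κ * fatMeetProb l N ≤ dcJoinProb l N

/-- The typed split composes: `Q1 ∧ Q2 → DCJoinFloor`. -/
theorem dcJoinFloor_of_fatClustersMeet_of_loopImpact :
    FatClustersMeet → LoopImpact → DCJoinFloor := by
  rintro ⟨c, hc, hF⟩ ⟨κ, hκ, hI⟩
  refine ⟨κ * c, mul_pos hκ hc, fun l hl => ?_⟩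
  obtain ⟨N₁, h₁⟩ := hF l hl
  obtain ⟨N₂, h₂⟩ := hI l hl
  refine ⟨max N₁ N₂, fun N hN => ?_⟩
  have h1 := h₁ N (le_trans (le_max_left _ _) hN)
  have h2 := h₂ N (le_trans (le_max_right _ _) hN)
  calc κ * c ≤ κ * fatMeetProb l N := mul_le_mul_of_nonneg_left h1 hκ.le
    _ ≤ dcJoinProb l N := h2

/-- GLUE HYPOTHESIS (not proved here): Aizenman's identity `−U₄ = 2⟨σσ⟩⟨σσ⟩ q` in the free box
(`ursellFour_eq_doubleCurrent`, named fact) and the box → infinite-volume limit of the critical 2- and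
4-point functions give `2 q_N(l) → R4ratio l`. -/
def AizenmanIdentityLimit : Prop :=
  ∀ l : ℕ, 1 ≤ l → Tendsto (fun N => 2 * dcJoinProb l N) atTop (𝓝 (R4ratio l))

/-- Under the glue hypothesis, `DCJoinFloor` gives the crux BY NAME (via the landed
`independentStrandsJoin_iff_forall_R4ratio`). -/
theorem independentStrandsJoin_of_dcJoinFloor (hA : AizenmanIdentityLimit) (h : DCJoinFloor) :
    IndependentStrandsJoin := by
  rw [independentStrandsJoin_iff_forall_R4ratio]
  obtain ⟨c, hc, hall⟩ := h
  refine ⟨c, hc, fun l hl => ?_⟩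
  obtain ⟨N₀, hN₀⟩ := hall l hl
  have h2c : 2 * c ≤ R4ratio l := by
    refine ge_of_tendsto (hA l hl) ?_
    filter_upwards [eventually_ge_atTop N₀] with N hN
    have := hN₀ N hN
    linarith
  linarith

/-- So the split concludes the crux: `AizenmanIdentityLimit → FatClustersMeet → LoopImpact → crux`. -/
theorem independentStrandsJoin_of_split (hA : AizenmanIdentityLimit) (h1 : FatClustersMeet)
    (h2 : LoopImpact) : IndependentStrandsJoin :=
  independentStrandsJoin_of_dcJoinFloor hA (dcJoinFloor_of_fatClustersMeet_of_loopImpact h1 h2)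

/-! ## §2 Strengthenings -/

/-- S⁺₁ (inductive, WITH teeth, numerically FALSE): anti-screening monotonicity of the merging ratio.
With the proved per-scale positivity it would give the crux at once; MC (Disproof § C) has `R₄`
DECREASING by ≈ 4 % from `l = 1` to the scaling curve. -/
def R4Nondecreasing : Prop := ∀ l : ℕ, 1 ≤ l → R4ratio l ≤ R4ratio (l + 1)

/-- S⁺₂ (inductive, numerically consistent, no handle): scale-to-scale stability of non-Gaussianity with
summable relative losses — the IR-attractivity of the non-Gaussian fixed point read on one observable. -/
def OctaveStability : Prop :=
  ∃ ε : ℕ → ℝ, Summable ε ∧ (∀ l, 0 ≤ ε l ∧ ε l < 1) ∧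
    ∀ l : ℕ, 1 ≤ l → (1 - ε l) * R4ratio l ≤ R4ratio (l + 1)

/-- S⁺₁ plus positivity at scale one gives the uniform floor (the induction the crux lacks). -/
theorem forall_R4ratio_of_nondecreasing (hmono : R4Nondecreasing) {c : ℝ} (h1 : c ≤ R4ratio 1) :
    ∀ l : ℕ, 1 ≤ l → c ≤ R4ratio l := by
  intro l hl
  induction l with
  | zero => exact absurd hl (by norm_num)
  | succ n ih =>
    rcases Nat.eq_zero_or_pos n with h0 | hpos
    · subst h0; simpa using h1
    · exact le_trans (ih hpos) (hmono n hpos)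

/-! ## §3 Negation target -/

/-- The counterexample any refutation must build: tetrahedral Gaussianity of critical 3D Ising. -/
def TetraGaussianity : Prop := Tendsto R4ratio atTop (𝓝 0)

/-- `TetraGaussianity` refutes the crux (and nothing weaker than `liminf R4ratio = 0` does, by
`independentStrandsJoin_iff_forall_R4ratio` and per-scale positivity). -/
theorem not_independentStrandsJoin_of_tetraGaussianity (hG : TetraGaussianity) :
    ¬ IndependentStrandsJoin := by
  intro h
  rw [independentStrandsJoin_iff_forall_R4ratio] at h
  obtain ⟨c, hc, hall⟩ := h
  have hev : ∀ᶠ l in atTop, R4ratio l < c := hG.eventually (gt_mem_nhds hc)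
  obtain ⟨l, hl⟩ := (hev.and (eventually_ge_atTop 1)).exists
  exact (not_lt.mpr (hall l hl.2)) hl.1

/-! ## §4 A weaker unknown consequence (pure two-point statement) -/

/-- `TreeDiagramFloor`: Aizenman's tree diagram at the dilated tetrahedron is non-degenerate relative to
`⟨σσ⟩⟨σσ⟩`, uniformly in the scale: `c·GGcrit l ≤ 2 Σ_u G(A₀−u)G(u−A₁)G(A₂−u)G(u−A₃)`
(`G = criticalTwoPoint 3`, box-truncated sums, eventually in the box).  IMPLIED by the crux through the
tree-diagram bound `−U₄ ≤ 2 Σ_u GGGG` (Aizenman 1982 Prop. 5.3; ADC 2021 (4.2) + Prop. A.3); a pure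
two-point (`η ≤ 1/2`-type) statement, itself OPEN on `ℤ³`; it implies nothing back. -/
def TreeDiagramFloor : Prop :=
  ∃ c : ℝ, 0 < c ∧ ∀ l : ℕ, 1 ≤ l → ∃ N₀ : ℕ, ∀ N : ℕ, N₀ ≤ N →
    c * GGcrit l ≤ 2 * ∑ u ∈ box 3 N,
      criticalTwoPoint 3 (u - A l 0) * criticalTwoPoint 3 (A l 1 - u) *
        (criticalTwoPoint 3 (u - A l 2) * criticalTwoPoint 3 (A l 3 - u))

end Summit.CriticalPhenomena.Ising3DConformalLimit.Cruxes.IndependentStrandsJoin.CensusS7
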